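import Literature.NumberTheory.LFunctions.ProlateEigenvalueLegendreBounds
import Literature.NumberTheory.LFunctions.ConnesProlateGuessWindow
import HarnessLib

/-!
# An elementary bound for the endpoint value `f(λ)` of a prolate function (Bonami–Karoui)

THIS IS NOT AN RH STATEMENT.  For the prolate function `h_{n,λ}` of the tree's interface
`IsProlateFunction lam n f` (eigen-equation `−((λ² − x²) f′)′ + (2πλx)² f = χ f` on `(−λ, λ)`,
`∫_{−λ}^{λ} f² = 1`, `f` even) in the OSCILLATORY regime `χ > c²`, `c = 2πλ²` (Bonami–Karoui's `q < 1`;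
for `λ = 1` this is every even index `≥ 6`), we prove:

* `IsProlateFunction.sq_le_sq_apply_lam` — `f(t)² ≤ f(λ)²` on `[0, λ]`: the supremum of `|f|` is the
  endpoint value [Osipov 2013, Prop. 12 / Thm. 25: "if `χ_n > c²`, `|ψ_n(x)| < |ψ_n(y)| < |ψ_n(1)|` for
  extrema `|x| < |y|`"; Bonami–Karoui 2014, p. 230: "for `q ≤ 1` the maximum of `|ψ_n|` inside `[0, 1]`
  is attained at `1`"], by the monotonicity of the Sonin function `S = f² + (λ²−t²)f′²/(χ − (2πλt)²)`,
  `S′ = 2t f′² (χ + c² − 2(2πλt)²)/(χ − (2πλt)²)² ≥ 0`;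
* `IsProlateFunction.weight_mul_sq_le` — `(λ²−t²)(χ − (2πλt)²) f(t)² ≤ λ(χ + c²)` on `[0, λ]`
  [Bonami–Karoui 2014, Thm. 2.1 and its proof, auxiliary function (6)]: `z = (λ²−t²)(χ−(2πλt)²)f² +
  ((λ²−t²)f′)²` has `z′ = −2t(χ + c² − 2(2πλt)²) f² ≤ 0`, `z(λ) = 0`, so
  `z(t) ≤ z(0) = ∫_0^λ 2t(χ + c² − 2(2πλt)²)f² ≤ 2λ(χ+c²)∫_0^λ f² = λ(χ + c²)`;
* `IsProlateFunction.abs_apply_lam_sub_le` — the endpoint Lipschitz estimate [Bonami–Karoui 2014,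
  eq. (13)]: `(λ²−t²)f′(t) = ∫_t^λ (χ − (2πλs)²) f(s) ds`, so `|f′(t)| ≤ |f(λ)|(χ − (2πλt)²)/λ` and
  `|f(λ) − f(x)| ≤ |f(λ)|·(λ²−x²)(χ−(2πλx)²)/λ²` for `x ∈ [0, λ]`;
* `IsProlateFunction.lam_mul_sq_apply_le` — **the endpoint bound** `λ·f(λ)² ≤ (27/4)(χ + c²)`:
  at the point `x₀` where `(λ²−x₀²)(χ−(2πλx₀)²) = λ²/3` the two previous items give
  `f(x₀)² ≤ 3(χ+c²)/λ` and `|f(x₀)| ≥ (2/3)|f(λ)|`.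

This is a WEAK form (constants `(27/4)(χ+c²)` instead of `κ₁²χ^{1/2}`, `κ₁ = (5/4)^{5/4}`) of
[Bonami–Karoui 2014, Thm. 3.1 eq. (12)] `|ψ_{n,c}(1)| ≤ κ₁ χ_n(c)^{1/4}`, whose proof needs the WKB form
(9) of their Prop. 2.1; the weak form uses only (6) and (13) loc. cit. and is what Connes–Consani 2021,
App. F needs (file `ConnesConsani2021/SeriesRemainderRokhlinFree.lean`).  CONTEXT: the sharper
"emblematic" estimate `|ψ_{n,c}(1)| < (n+½)^{1/2}` of [Rokhlin–Xiao 2007, Thm. 12] (used by CC 2021 as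
(100)/(Rokh)) is stated there WITHOUT proof ("listed without proofs", loc. cit. p. 116) and, according to
[Bonami–Karoui 2014, p. 230], "frequently cited (but not proved) in the literature … an analytic proof
seems to be difficult to obtain"; nothing in this file proves or uses it.

## References

* A. Bonami, A. Karoui, *Uniform bounds of prolate spheroidal wave functions and eigenvalues decay*,
  C. R. Math. Acad. Sci. Paris 352 (2014) 229–234, Thm. 2.1 (auxiliary function (6)), eq. (13),
  Thm. 3.1. [cite: BonamiKaroui2014, Thm. 2.1, eq. (13)]
* A. Osipov, *Certain inequalities involving prolate spheroidal wave functions and associated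
  quantities*, Appl. Comput. Harmon. Anal. 35 (2013) 359–393, Prop. 12 (arXiv:1206.4056 Thm. 25).
  [cite: Osipov2013, Prop. 12]

Nothing here concerns `ζ` or RH.
-/

noncomputable section

open Real Set Filter Topology MeasureTheory intervalIntegral

namespace Literature.NumberTheory.LFunctions

namespace IsProlateFunction

variable {lam : ℝ} {n : ℕ} {f : ℝ → ℝ} {χ : ℝ}

/-! ### The oscillatory regime `χ > c² = (2πλ²)²` -/

/-- In the regime `(2πλ²)² < χ` the potential `χ − (2πλx)²` is positive on `[−λ, λ]`
(`(2πλx)² ≤ (2πλ²)²` for `|x| ≤ λ`). [cite: BonamiKaroui2014, eq. (3)] -/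
theorem potential_pos (hf : IsProlateFunction lam n f) (hc : (2 * π * lam ^ 2) ^ 2 < χ) {x : ℝ}
    (hx : x ∈ Icc (-lam) lam) : 0 < χ - (2 * π * lam * x) ^ 2 := by
  have _ := hf.lam_pos
  have hx2 : x ^ 2 ≤ lam ^ 2 := by nlinarith [hx.1, hx.2]
  have h : (2 * π * lam * x) ^ 2 ≤ (2 * π * lam ^ 2) ^ 2 := by
    have h0 : 0 ≤ (2 * π * lam) ^ 2 := sq_nonneg _
    nlinarith [mul_le_mul_of_nonneg_left hx2 h0]
  linarith

/-- `(2πλx)² ≤ (2πλ²)² = c²` for `|x| ≤ λ`. [cite: BonamiKaroui2014, eq. (3)] -/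
theorem sq_potential_le (hf : IsProlateFunction lam n f) {x : ℝ} (hx : x ∈ Icc (-lam) lam) :
    (2 * π * lam * x) ^ 2 ≤ (2 * π * lam ^ 2) ^ 2 := by
  have _ := hf.lam_pos
  have hx2 : x ^ 2 ≤ lam ^ 2 := by nlinarith [hx.1, hx.2]
  have h0 : 0 ≤ (2 * π * lam) ^ 2 := sq_nonneg _
  nlinarith [mul_le_mul_of_nonneg_left hx2 h0]

/-- In the regime `(2πλ²)² < χ` the index is positive (`χ_0 < c²` by `eigen_lt`), hence `χ > 2`.
[cite: WangLL2010, Lemma 2.2] -/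
theorem two_lt_eigen_of (hf : IsProlateFunction lam n f)
    (hχ : ∀ x ∈ Ioo (-lam) lam,
      -(deriv (fun y ↦ (lam ^ 2 - y ^ 2) * deriv f y) x) + (2 * π * lam * x) ^ 2 * f x = χ * f x)
    (hc : (2 * π * lam ^ 2) ^ 2 < χ) : 2 < χ := by
  have h1 := hf.lt_eigen hχ
  have h2 := hf.eigen_lt hχ
  rcases Nat.eq_zero_or_pos n with rfl | hn
  · simp at h2; linarith
  · have hn' : (1 : ℝ) ≤ n := by exact_mod_cast hn
    nlinarith

/-! ### The maximum of `|f|` on `[0, λ]` is the endpoint value (Sonin's function) -/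

/-- **`|f| ≤ |f(λ)|` on `[0, λ]` when `χ > c²`** [Osipov 2013, Prop. 12; Bonami–Karoui 2014, p. 230]:
the Sonin function `S(t) = f(t)² + (λ²−t²) f′(t)²/(χ − (2πλt)²)` is non-decreasing on `[0, λ]`
(`S′ = 2t f′²(χ + c² − 2(2πλt)²)/(χ − (2πλt)²)² ≥ 0` by the equation) and `S(λ) = f(λ)²`.
[cite: Osipov2013, Prop. 12] [cite: BonamiKaroui2014, §2 p. 230] -/
theorem sq_le_sq_apply_lam (hf : IsProlateFunction lam n f)
    (hχ : ∀ x ∈ Ioo (-lam) lam,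
      -(deriv (fun y ↦ (lam ^ 2 - y ^ 2) * deriv f y) x) + (2 * π * lam * x) ^ 2 * f x = χ * f x)
    (hc : (2 * π * lam ^ 2) ^ 2 < χ) {t : ℝ} (ht : t ∈ Icc 0 lam) : f t ^ 2 ≤ f lam ^ 2 := by
  have hlam := hf.lam_pos
  set f₁ : ℝ → ℝ := derivWithin f (Icc (-lam) lam) with hf₁
  have hfc : ContinuousOn f (Icc (-lam) lam) := hf.contDiffOn.continuousOn
  have hf₁c : ContinuousOn f₁ (Icc (-lam) lam) := hf.continuousOn_derivWithin
  have hsub : Icc 0 lam ⊆ Icc (-lam) lam := Icc_subset_Icc (by linarith) le_rfl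
  have hq : ∀ x ∈ Icc (-lam) lam, 0 < χ - (2 * π * lam * x) ^ 2 := fun x hx ↦ hf.potential_pos hc hx
  -- the Sonin function
  set S : ℝ → ℝ := fun x ↦ f x ^ 2 + (lam ^ 2 - x ^ 2) * f₁ x * f₁ x / (χ - (2 * π * lam * x) ^ 2)
    with hS
  have hSc : ContinuousOn S (Icc 0 lam) := by
    refine ((hfc.mono hsub).pow 2).add (ContinuousOn.div ?_ ?_ fun x hx ↦ (hq x (hsub hx)).ne')
    · exact ((Continuous.continuousOn (by fun_prop)).mul (hf₁c.mono hsub)).mul (hf₁c.mono hsub)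
    · exact Continuous.continuousOn (by fun_prop)
  have hSd : ∀ x ∈ Ioo 0 lam, HasDerivAt S
      (2 * x * f₁ x ^ 2 * ((χ - (2 * π * lam * x) ^ 2) + (2 * π * lam) ^ 2 * (lam ^ 2 - x ^ 2))
        / (χ - (2 * π * lam * x) ^ 2) ^ 2) x := by
    intro x hx
    have hx' : x ∈ Ioo (-lam) lam := ⟨by linarith [hx.1], hx.2⟩
    have hqx := hq x (Ioo_subset_Icc_self hx')
    have hfd : HasDerivAt f (f₁ x) x := hf.hasDerivAt_derivWithin hx'
    have hf₁d : HasDerivAt f₁ (deriv (deriv f) x) x := by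
      have h := (hf.differentiableAt_deriv hx').hasDerivAt
      refine h.congr_of_eventuallyEq ?_
      filter_upwards [isOpen_Ioo.mem_nhds hx'] with y hy
      exact derivWithin_of_mem_nhds (Icc_mem_nhds hy.1 hy.2)
    have hF : HasDerivAt (fun y ↦ (lam ^ 2 - y ^ 2) * f₁ y) (((2 * π * lam * x) ^ 2 - χ) * f x) x :=
      hf.hasDerivAt_flux hχ hx'
    have hQ : HasDerivAt (fun y : ℝ ↦ χ - (2 * π * lam * y) ^ 2)
        (-(2 * (2 * π * lam * x) * (2 * π * lam))) x := by
      have h1 : HasDerivAt (fun y : ℝ ↦ 2 * π * lam * y) (2 * π * lam) x := by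
        simpa using (hasDerivAt_id x).const_mul (2 * π * lam)
      have h2 := (h1.mul h1).const_sub χ
      refine (h2.congr_of_eventuallyEq (Eventually.of_forall fun y ↦ ?_)).congr_deriv (by ring)
      simp only [Pi.mul_apply]
      ring
    have hnum : HasDerivAt (fun y ↦ (lam ^ 2 - y ^ 2) * f₁ y * f₁ y)
        (((2 * π * lam * x) ^ 2 - χ) * f x * f₁ x + (lam ^ 2 - x ^ 2) * f₁ x * deriv (deriv f) x) x :=
      hF.mul hf₁d
    have hfrac := hnum.div hQ hqx.ne'
    have hsq : HasDerivAt (fun y ↦ f y ^ 2) (2 * f x * f₁ x) x := by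
      refine ((hfd.mul hfd).congr_of_eventuallyEq (Eventually.of_forall fun y ↦ ?_)).congr_deriv
        (by ring)
      simp only [Pi.mul_apply]
      ring
    have hode := hf.ode_of_eigen hχ x hx'
    rw [hfd.deriv] at hode
    -- `(λ² − x²) f″ = 2x f′ + ((2πλx)² − χ) f`
    refine (hsq.add hfrac).congr_deriv ?_
    have hd0 : (χ - (2 * π * lam * x) ^ 2) ^ 2 ≠ 0 := pow_ne_zero 2 hqx.ne'
    rw [eq_div_iff hd0, add_mul, div_mul_cancel₀ _ hd0]
    linear_combination (f₁ x * (χ - (2 * π * lam * x) ^ 2)) * hode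
  have hmono : MonotoneOn S (Icc 0 lam) := by
    apply monotoneOn_of_deriv_nonneg (convex_Icc 0 lam) hSc
    · rw [interior_Icc]
      exact fun x hx ↦ (hSd x hx).differentiableAt.differentiableWithinAt
    · rw [interior_Icc]
      intro x hx
      rw [(hSd x hx).deriv]
      have hx' : x ∈ Ioo (-lam) lam := ⟨by linarith [hx.1], hx.2⟩
      have hqx := hq x (Ioo_subset_Icc_self hx')
      have hpx : 0 < lam ^ 2 - x ^ 2 := by nlinarith [hx.1, hx.2]
      apply div_nonneg _ (sq_nonneg _)
      have h1 : 0 ≤ 2 * x * f₁ x ^ 2 := by nlinarith [hx.1, sq_nonneg (f₁ x)]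
      exact mul_nonneg h1 (by nlinarith [sq_nonneg (2 * π * lam)])
  have h1 : f t ^ 2 ≤ S t := by
    have hqt := hq t (hsub ht)
    have hpt : 0 ≤ lam ^ 2 - t ^ 2 := by nlinarith [ht.1, ht.2]
    have : 0 ≤ (lam ^ 2 - t ^ 2) * f₁ t * f₁ t / (χ - (2 * π * lam * t) ^ 2) :=
      div_nonneg (by nlinarith [sq_nonneg (f₁ t)]) hqt.le
    simp only [hS]
    linarith
  have h2 : S t ≤ S lam := hmono ht (right_mem_Icc.2 hlam.le) ht.2
  have h3 : S lam = f lam ^ 2 := by simp [hS]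
  linarith

/-- Corollary: `|f(t)| ≤ |f(λ)|` on `[0, λ]` when `χ > c²`. [cite: Osipov2013, Prop. 12] -/
theorem abs_le_abs_apply_lam (hf : IsProlateFunction lam n f)
    (hχ : ∀ x ∈ Ioo (-lam) lam,
      -(deriv (fun y ↦ (lam ^ 2 - y ^ 2) * deriv f y) x) + (2 * π * lam * x) ^ 2 * f x = χ * f x)
    (hc : (2 * π * lam ^ 2) ^ 2 < χ) {t : ℝ} (ht : t ∈ Icc 0 lam) : |f t| ≤ |f lam| :=
  sq_le_sq.mp (hf.sq_le_sq_apply_lam hχ hc ht)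

/-! ### Bonami–Karoui's auxiliary function: a weighted sup bound

(`∫_0^λ f² = 1/2` is `IsProlateFunction.integral_sq_half` of `ConnesProlateGuessWindow.lean`.) -/

/-- **Weighted bound** [Bonami–Karoui 2014, Thm. 2.1, auxiliary function (6)]: for `χ > c² = (2πλ²)²`
and `t ∈ [0, λ]`, `(λ² − t²)(χ − (2πλt)²) f(t)² ≤ λ(χ + c²)`.  With
`z = (λ²−t²)(χ−(2πλt)²)f² + ((λ²−t²)f′)²`: `z′ = −2t(χ + c² − 2(2πλt)²)f² ≤ 0` on `[0, λ]`,
`z(λ) = 0`, hence `z(t) ≤ z(0) = ∫_0^λ (−z′) ≤ 2λ(χ + c²)∫_0^λ f² = λ(χ + c²)`.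
[cite: BonamiKaroui2014, Thm. 2.1 (auxiliary function (6))] -/
theorem weight_mul_sq_le (hf : IsProlateFunction lam n f)
    (hχ : ∀ x ∈ Ioo (-lam) lam,
      -(deriv (fun y ↦ (lam ^ 2 - y ^ 2) * deriv f y) x) + (2 * π * lam * x) ^ 2 * f x = χ * f x)
    (hc : (2 * π * lam ^ 2) ^ 2 < χ) {t : ℝ} (ht : t ∈ Icc 0 lam) :
    (lam ^ 2 - t ^ 2) * (χ - (2 * π * lam * t) ^ 2) * f t ^ 2 ≤
      lam * (χ + (2 * π * lam ^ 2) ^ 2) := by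
  have hlam := hf.lam_pos
  set f₁ : ℝ → ℝ := derivWithin f (Icc (-lam) lam) with hf₁
  have hfc : ContinuousOn f (Icc (-lam) lam) := hf.contDiffOn.continuousOn
  have hf₁c : ContinuousOn f₁ (Icc (-lam) lam) := hf.continuousOn_derivWithin
  have hsub : Icc 0 lam ⊆ Icc (-lam) lam := Icc_subset_Icc (by linarith) le_rfl
  have hI : uIcc 0 lam = Icc 0 lam := uIcc_of_le hlam.le
  -- the auxiliary function and its derivative
  set z : ℝ → ℝ := fun y ↦ (lam ^ 2 - y ^ 2) * (χ - (2 * π * lam * y) ^ 2) * f y ^ 2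
      + ((lam ^ 2 - y ^ 2) * f₁ y) ^ 2 with hz
  set z' : ℝ → ℝ := fun y ↦
      -(2 * y * (χ + (2 * π * lam ^ 2) ^ 2 - 2 * (2 * π * lam * y) ^ 2) * f y ^ 2) with hz'
  have hzd : ∀ x ∈ Ioo (-lam) lam, HasDerivAt z (z' x) x := by
    intro x hx
    have hfd : HasDerivAt f (f₁ x) x := hf.hasDerivAt_derivWithin hx
    have hF : HasDerivAt (fun y ↦ (lam ^ 2 - y ^ 2) * f₁ y) (((2 * π * lam * x) ^ 2 - χ) * f x) x :=
      hf.hasDerivAt_flux hχ hx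
    have hp : HasDerivAt (fun y : ℝ ↦ lam ^ 2 - y ^ 2) (-(2 * x)) x := by
      simpa using (hasDerivAt_pow 2 x).const_sub (lam ^ 2)
    have hQ : HasDerivAt (fun y : ℝ ↦ χ - (2 * π * lam * y) ^ 2)
        (-(2 * (2 * π * lam * x) * (2 * π * lam))) x := by
      have h1 : HasDerivAt (fun y : ℝ ↦ 2 * π * lam * y) (2 * π * lam) x := by
        simpa using (hasDerivAt_id x).const_mul (2 * π * lam)
      have h2 := (h1.mul h1).const_sub χ
      refine (h2.congr_of_eventuallyEq (Eventually.of_forall fun y ↦ ?_)).congr_deriv (by ring)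
      simp only [Pi.mul_apply]
      ring
    have hsq : HasDerivAt (fun y ↦ f y ^ 2) (2 * f x * f₁ x) x := by
      refine ((hfd.mul hfd).congr_of_eventuallyEq (Eventually.of_forall fun y ↦ ?_)).congr_deriv
        (by ring)
      simp only [Pi.mul_apply]
      ring
    have h := ((hp.mul hQ).mul hsq).add (hF.mul hF)
    refine (h.congr_of_eventuallyEq (Eventually.of_forall fun y ↦ ?_)).congr_deriv ?_
    · simp only [hz, Pi.add_apply, Pi.mul_apply]
      ring
    · simp only [hz', Pi.mul_apply]
      ring
  have hzc : ContinuousOn z (Icc (-lam) lam) := by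
    refine ContinuousOn.add ?_ ((((Continuous.continuousOn (by fun_prop)).mul hf₁c)).pow 2)
    exact ((Continuous.continuousOn (by fun_prop)).mul (Continuous.continuousOn (by fun_prop))).mul
      (hfc.pow 2)
  have hz'c : ContinuousOn z' (Icc (-lam) lam) :=
    ((Continuous.continuousOn (by fun_prop)).mul (hfc.pow 2)).neg
  -- `z` is non-increasing on `[0, λ]`
  have hanti : AntitoneOn z (Icc 0 lam) := by
    apply antitoneOn_of_deriv_nonpos (convex_Icc 0 lam) (hzc.mono hsub)
    · rw [interior_Icc]
      exact fun x hx ↦ (hzd x ⟨by linarith [hx.1], hx.2⟩).differentiableAt.differentiableWithinAt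
    · rw [interior_Icc]
      intro x hx
      rw [(hzd x ⟨by linarith [hx.1], hx.2⟩).deriv, hz']
      have hpot : 0 < χ - (2 * π * lam * x) ^ 2 :=
        hf.potential_pos hc ⟨by linarith [hx.1], hx.2.le⟩
      have hcx := hf.sq_potential_le (x := x) ⟨by linarith [hx.1], hx.2.le⟩
      have h1 : 0 ≤ χ + (2 * π * lam ^ 2) ^ 2 - 2 * (2 * π * lam * x) ^ 2 := by linarith
      have h2 : 0 ≤ 2 * x * (χ + (2 * π * lam ^ 2) ^ 2 - 2 * (2 * π * lam * x) ^ 2) * f x ^ 2 :=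
        mul_nonneg (mul_nonneg (by linarith [hx.1]) h1) (sq_nonneg _)
      linarith
  -- `z(0) = ∫_0^λ (−z′) ≤ λ(χ + c²)`
  have hint : IntervalIntegrable z' volume 0 lam := (hI ▸ hz'c.mono hsub).intervalIntegrable
  have hFTC : ∫ x in (0 : ℝ)..lam, z' x = z lam - z 0 :=
    integral_eq_sub_of_hasDerivAt_of_le hlam.le (hzc.mono hsub)
      (fun x hx ↦ hzd x ⟨by linarith [hx.1], hx.2⟩) hint
  have hzlam : z lam = 0 := by simp [hz]
  have hz0 : z 0 ≤ lam * (χ + (2 * π * lam ^ 2) ^ 2) := by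
    have hbound : ∫ x in (0 : ℝ)..lam, -z' x ≤
        ∫ x in (0 : ℝ)..lam, 2 * lam * (χ + (2 * π * lam ^ 2) ^ 2) * f x ^ 2 := by
      refine intervalIntegral.integral_mono_on hlam.le hint.neg ?_ fun x hx ↦ ?_
      · exact (ContinuousOn.intervalIntegrable (by
          rw [hI]; exact (Continuous.continuousOn (by fun_prop)).mul ((hfc.mono hsub).pow 2)))
      · simp only [hz', neg_neg]
        have hpot : 0 < χ - (2 * π * lam * x) ^ 2 := hf.potential_pos hc (hsub hx)
        have hcx := hf.sq_potential_le (hsub hx)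
        have h1 : χ + (2 * π * lam ^ 2) ^ 2 - 2 * (2 * π * lam * x) ^ 2 ≤
            χ + (2 * π * lam ^ 2) ^ 2 := by nlinarith [sq_nonneg (2 * π * lam * x)]
        have h2 : 0 ≤ χ + (2 * π * lam ^ 2) ^ 2 - 2 * (2 * π * lam * x) ^ 2 := by linarith
        have h3 : 2 * x * (χ + (2 * π * lam ^ 2) ^ 2 - 2 * (2 * π * lam * x) ^ 2) ≤
            2 * lam * (χ + (2 * π * lam ^ 2) ^ 2) :=
          mul_le_mul (by linarith [hx.2]) h1 h2 (by positivity)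
        exact mul_le_mul_of_nonneg_right h3 (sq_nonneg _)
    rw [intervalIntegral.integral_neg, hFTC, hzlam, intervalIntegral.integral_const_mul,
      hf.integral_sq_half] at hbound
    linarith
  -- conclude
  have hzt : z t ≤ z 0 := hanti (left_mem_Icc.2 hlam.le) ht ht.1
  have hmain : (lam ^ 2 - t ^ 2) * (χ - (2 * π * lam * t) ^ 2) * f t ^ 2 ≤ z t := by
    simp only [hz]
    nlinarith [sq_nonneg ((lam ^ 2 - t ^ 2) * f₁ t)]
  linarith

/-! ### The endpoint Lipschitz estimate -/

/-- The flux as a tail integral: `(λ²−t²) f′(t) = ∫_t^λ (χ − (2πλs)²) f(s) ds` for `t ∈ [0, λ]`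
(the flux vanishes at `λ`). [cite: BonamiKaroui2014, eq. (13)] -/
theorem flux_eq_integral (hf : IsProlateFunction lam n f)
    (hχ : ∀ x ∈ Ioo (-lam) lam,
      -(deriv (fun y ↦ (lam ^ 2 - y ^ 2) * deriv f y) x) + (2 * π * lam * x) ^ 2 * f x = χ * f x)
    {t : ℝ} (ht : t ∈ Icc 0 lam) :
    (lam ^ 2 - t ^ 2) * derivWithin f (Icc (-lam) lam) t =
      ∫ s in t..lam, (χ - (2 * π * lam * s) ^ 2) * f s := by
  have hlam := hf.lam_pos
  set f₁ : ℝ → ℝ := derivWithin f (Icc (-lam) lam) with hf₁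
  have hfc : ContinuousOn f (Icc (-lam) lam) := hf.contDiffOn.continuousOn
  have hf₁c : ContinuousOn f₁ (Icc (-lam) lam) := hf.continuousOn_derivWithin
  have hsub : Icc t lam ⊆ Icc (-lam) lam := Icc_subset_Icc (by linarith [ht.1]) le_rfl
  have hI : uIcc t lam = Icc t lam := uIcc_of_le ht.2
  have hFc : ContinuousOn (fun y ↦ (lam ^ 2 - y ^ 2) * f₁ y) (Icc t lam) :=
    ((Continuous.continuousOn (by fun_prop)).mul (hf₁c.mono hsub))
  have hint : IntervalIntegrable (fun s ↦ ((2 * π * lam * s) ^ 2 - χ) * f s) volume t lam := by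
    refine ContinuousOn.intervalIntegrable ?_
    rw [hI]
    exact (Continuous.continuousOn (by fun_prop)).mul (hfc.mono hsub)
  have hFTC : ∫ s in t..lam, ((2 * π * lam * s) ^ 2 - χ) * f s =
      (lam ^ 2 - lam ^ 2) * f₁ lam - (lam ^ 2 - t ^ 2) * f₁ t :=
    integral_eq_sub_of_hasDerivAt_of_le ht.2 hFc
      (fun x hx ↦ hf.hasDerivAt_flux hχ ⟨by linarith [hx.1, ht.1], hx.2⟩) hint
  have : ∫ s in t..lam, (χ - (2 * π * lam * s) ^ 2) * f s =
      -∫ s in t..lam, ((2 * π * lam * s) ^ 2 - χ) * f s := by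
    rw [← intervalIntegral.integral_neg]
    exact integral_congr fun x _ ↦ by ring
  rw [this, hFTC]
  ring

/-- **Endpoint Lipschitz estimate** [Bonami–Karoui 2014, eq. (13) and the line after]: for `χ > c²` and
`x ∈ [0, λ]`, `|f(λ) − f(x)| ≤ |f(λ)| · (λ² − x²)(χ − (2πλx)²)/λ²` (from
`|f′(t)| ≤ |f(λ)|(χ − (2πλt)²)/λ` on `[x, λ)`, which uses `|f| ≤ |f(λ)|` and the monotonicity of the
potential). [cite: BonamiKaroui2014, eq. (13)] -/
theorem abs_apply_lam_sub_le (hf : IsProlateFunction lam n f)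
    (hχ : ∀ x ∈ Ioo (-lam) lam,
      -(deriv (fun y ↦ (lam ^ 2 - y ^ 2) * deriv f y) x) + (2 * π * lam * x) ^ 2 * f x = χ * f x)
    (hc : (2 * π * lam ^ 2) ^ 2 < χ) {x : ℝ} (hx : x ∈ Icc 0 lam) :
    |f lam - f x| ≤ |f lam| * ((lam ^ 2 - x ^ 2) * (χ - (2 * π * lam * x) ^ 2)) / lam ^ 2 := by
  have hlam := hf.lam_pos
  have hfc : ContinuousOn f (Icc (-lam) lam) := hf.contDiffOn.continuousOn
  have hf₁c : ContinuousOn (derivWithin f (Icc (-lam) lam)) (Icc (-lam) lam) :=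
    hf.continuousOn_derivWithin
  have hsub : Icc x lam ⊆ Icc (-lam) lam := Icc_subset_Icc (by linarith [hx.1]) le_rfl
  -- the potential `χ − (2πλs)²` is positive and non-increasing on `[0, λ]`
  have hqanti : ∀ s t : ℝ, 0 ≤ s → s ≤ t →
      χ - (2 * π * lam * t) ^ 2 ≤ χ - (2 * π * lam * s) ^ 2 := by
    intro s t hs hst
    have : (2 * π * lam * s) ^ 2 ≤ (2 * π * lam * t) ^ 2 :=
      pow_le_pow_left₀ (by positivity) (mul_le_mul_of_nonneg_left hst (by positivity)) 2
    linarith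
  have hqpos : ∀ s ∈ Icc (-lam) lam, 0 < χ - (2 * π * lam * s) ^ 2 :=
    fun s hs ↦ hf.potential_pos hc hs
  have hqx := hqpos x ⟨by linarith [hx.1], hx.2⟩
  -- derivative bound on `[x, λ)`
  have hderiv : ∀ t ∈ Ico x lam, |derivWithin f (Icc (-lam) lam) t| ≤
      |f lam| * (χ - (2 * π * lam * x) ^ 2) / lam := by
    intro t ht
    have ht0 : t ∈ Icc 0 lam := ⟨le_trans hx.1 ht.1, ht.2.le⟩
    have hpt : 0 < lam ^ 2 - t ^ 2 := by nlinarith [ht0.1, ht.2]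
    have hflux := hf.flux_eq_integral hχ ht0
    have hqt := hqpos t ⟨by linarith [ht0.1], ht0.2⟩
    -- `|∫_t^λ q f| ≤ q(t) |f(λ)| (λ − t)`
    have hbound : ‖∫ s in t..lam, (χ - (2 * π * lam * s) ^ 2) * f s‖ ≤
        (χ - (2 * π * lam * t) ^ 2) * |f lam| * |lam - t| := by
      refine intervalIntegral.norm_integral_le_of_norm_le_const fun s hs ↦ ?_
      rw [uIoc_of_le ht.2.le] at hs
      have hs0 : s ∈ Icc 0 lam := ⟨by linarith [ht0.1, hs.1], hs.2⟩
      rw [Real.norm_eq_abs, abs_mul, abs_of_pos (hqpos s ⟨by linarith [hs0.1], hs0.2⟩)]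
      exact mul_le_mul (hqanti t s ht0.1 hs.1.le) (hf.abs_le_abs_apply_lam hχ hc hs0)
        (abs_nonneg _) hqt.le
    rw [← hflux, Real.norm_eq_abs, abs_mul, abs_of_pos hpt,
      abs_of_nonneg (by linarith [ht.2] : (0 : ℝ) ≤ lam - t)] at hbound
    -- divide by `λ² − t² = (λ − t)(λ + t)` and use `λ + t ≥ λ`
    have hlt : 0 < lam - t := by linarith [ht.2]
    have h1 : (lam + t) * |derivWithin f (Icc (-lam) lam) t| ≤
        (χ - (2 * π * lam * t) ^ 2) * |f lam| := by
      have h' : (lam - t) * ((lam + t) * |derivWithin f (Icc (-lam) lam) t|) ≤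
          (lam - t) * ((χ - (2 * π * lam * t) ^ 2) * |f lam|) := by
        have e : (lam ^ 2 - t ^ 2) = (lam - t) * (lam + t) := by ring
        rw [e, mul_assoc] at hbound
        linarith
      exact le_of_mul_le_mul_left h' hlt
    have h2 : lam * |derivWithin f (Icc (-lam) lam) t| ≤
        |f lam| * (χ - (2 * π * lam * x) ^ 2) := by
      have hqtx := hqanti x t hx.1 ht.1
      nlinarith [abs_nonneg (derivWithin f (Icc (-lam) lam) t), abs_nonneg (f lam), ht0.1]
    rw [le_div_iff₀ hlam]
    linarith
  -- integrate: `f(λ) − f(x) = ∫_x^λ f′`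
  have hint : IntervalIntegrable (derivWithin f (Icc (-lam) lam)) volume x lam :=
    ContinuousOn.intervalIntegrable (by rw [uIcc_of_le hx.2]; exact hf₁c.mono hsub)
  have hFTC : ∫ s in x..lam, derivWithin f (Icc (-lam) lam) s = f lam - f x :=
    integral_eq_sub_of_hasDerivAt_of_le hx.2 (hfc.mono hsub)
      (fun t ht ↦ hf.hasDerivAt_derivWithin ⟨by linarith [ht.1, hx.1], ht.2⟩) hint
  have hae : ∀ᵐ s : ℝ, s ≠ lam := by
    rw [ae_iff]; simp
  have hbound : ‖∫ s in x..lam, derivWithin f (Icc (-lam) lam) s‖ ≤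
      |f lam| * (χ - (2 * π * lam * x) ^ 2) / lam * |lam - x| := by
    refine intervalIntegral.norm_integral_le_of_norm_le_const_ae ?_
    filter_upwards [hae] with s hs1 hs
    rw [uIoc_of_le hx.2] at hs
    rw [Real.norm_eq_abs]
    exact hderiv s ⟨hs.1.le, lt_of_le_of_ne hs.2 hs1⟩
  rw [hFTC, Real.norm_eq_abs, abs_of_nonneg (by linarith [hx.2] : (0 : ℝ) ≤ lam - x)] at hbound
  -- `(λ − x) q(x)/λ ≤ (λ² − x²) q(x)/λ²`
  calc |f lam - f x| ≤ |f lam| * (χ - (2 * π * lam * x) ^ 2) / lam * (lam - x) := hbound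
    _ ≤ |f lam| * ((lam ^ 2 - x ^ 2) * (χ - (2 * π * lam * x) ^ 2)) / lam ^ 2 := by
        rw [div_mul_eq_mul_div, div_le_div_iff₀ hlam (by positivity)]
        have h1 : (lam - x) * lam ≤ lam ^ 2 - x ^ 2 := by nlinarith [hx.1, hx.2]
        have h0 : 0 ≤ |f lam| * (χ - (2 * π * lam * x) ^ 2) * lam := by positivity
        nlinarith [mul_le_mul_of_nonneg_left h1 h0]

/-! ### The endpoint bound -/

/-- **Endpoint bound** (weak form of [Bonami–Karoui 2014, Thm. 3.1 eq. (12)], from their Thm. 2.1 and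
eq. (13) only): for the prolate function `h_{n,λ}` with eigenvalue `χ > c² = (2πλ²)²`,
`λ · f(λ)² ≤ (27/4)(χ + c²)`.  At `x₀ ∈ [0, λ]` with `(λ²−x₀²)(χ−(2πλx₀)²) = λ²/3` (intermediate
value): `f(x₀)² ≤ 3(χ+c²)/λ` (`weight_mul_sq_le`) and `|f(x₀)| ≥ (2/3)|f(λ)|` (`abs_apply_lam_sub_le`).
[cite: BonamiKaroui2014, Thm. 2.1, eq. (13), Thm. 3.1] -/
theorem lam_mul_sq_apply_le (hf : IsProlateFunction lam n f)
    (hχ : ∀ x ∈ Ioo (-lam) lam,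
      -(deriv (fun y ↦ (lam ^ 2 - y ^ 2) * deriv f y) x) + (2 * π * lam * x) ^ 2 * f x = χ * f x)
    (hc : (2 * π * lam ^ 2) ^ 2 < χ) :
    lam * f lam ^ 2 ≤ 27 / 4 * (χ + (2 * π * lam ^ 2) ^ 2) := by
  have hlam := hf.lam_pos
  have hχ2 := hf.two_lt_eigen_of hχ hc
  have hfc : ContinuousOn f (Icc (-lam) lam) := hf.contDiffOn.continuousOn
  -- the weight `R(t) = (λ² − t²)(χ − (2πλt)²)` takes the value `λ²/3` on `[0, λ]`
  set R : ℝ → ℝ := fun t ↦ (lam ^ 2 - t ^ 2) * (χ - (2 * π * lam * t) ^ 2) with hR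
  have hRc : ContinuousOn R (Icc 0 lam) := Continuous.continuousOn (by simp only [hR]; fun_prop)
  have hR0 : R 0 = lam ^ 2 * χ := by simp [hR]
  have hRl : R lam = 0 := by simp [hR]
  have hmem : lam ^ 2 / 3 ∈ Icc (R lam) (R 0) := by
    rw [hR0, hRl]
    constructor
    · positivity
    · nlinarith [sq_nonneg lam]
  obtain ⟨x₀, hx₀, hRx₀⟩ := intermediate_value_Icc' hlam.le hRc hmem
  -- the two estimates at `x₀`
  have hI := hf.weight_mul_sq_le hχ hc hx₀
  have hII := hf.abs_apply_lam_sub_le hχ hc hx₀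
  have hRx₀' : (lam ^ 2 - x₀ ^ 2) * (χ - (2 * π * lam * x₀) ^ 2) = lam ^ 2 / 3 := hRx₀
  rw [hRx₀'] at hI hII
  -- `f(x₀)² ≤ 3(χ + c²)/λ`
  have h1 : lam * f x₀ ^ 2 ≤ 3 * (χ + (2 * π * lam ^ 2) ^ 2) := by nlinarith
  -- `|f(x₀)| ≥ (2/3)|f(λ)|`
  have h2 : 2 / 3 * |f lam| ≤ |f x₀| := by
    have h3 : |f lam| - |f x₀| ≤ |f lam - f x₀| := abs_sub_abs_le_abs_sub _ _
    have h4 : |f lam| * (lam ^ 2 / 3) / lam ^ 2 = |f lam| / 3 := by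
      field_simp
    rw [h4] at hII
    linarith
  have h5 : 4 / 9 * f lam ^ 2 ≤ f x₀ ^ 2 := by
    have := pow_le_pow_left₀ (by positivity) h2 2
    rw [mul_pow, sq_abs, sq_abs] at this
    nlinarith
  nlinarith [mul_le_mul_of_nonneg_left h5 hlam.le]

/-- **Endpoint bound at `λ = 1`** (the case used by Connes–Consani 2021, App. F: the even prolate
functions of bandwidth `2π` with `χ > 4π²`, i.e. every index `2n ≥ 6`): `ψ(1)² ≤ (27/4)(χ + 4π²)`.
[cite: BonamiKaroui2014, Thm. 2.1, eq. (13), Thm. 3.1] -/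
theorem sq_apply_one_le {m : ℕ} {ψ : ℝ → ℝ} {χ : ℝ} (hψ : IsProlateFunction 1 m ψ)
    (hχ : ∀ x ∈ Ioo (-1 : ℝ) 1,
      -(deriv (fun y ↦ (1 ^ 2 - y ^ 2) * deriv ψ y) x) + (2 * π * 1 * x) ^ 2 * ψ x = χ * ψ x)
    (hc : (2 * π) ^ 2 < χ) : ψ 1 ^ 2 ≤ 27 / 4 * (χ + (2 * π) ^ 2) := by
  have h := hψ.lam_mul_sq_apply_le hχ (by simpa using hc)
  simpa using h

end IsProlateFunction

end Literature.NumberTheory.LFunctions
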